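import Summits.QuantumFields.QCD.Theses.SpectralDefectExtinction
import Summits.QuantumFields.QCD.Theorems.ExtinctionBuildsQCD.Negative.WithoutTightCollapse
import Summits.QuantumFields.QCD.Theorems.ExtinctionBuildsQCD.Negative.TightPinsLine
import Summits.QuantumFields.QCD.Theorems.ExtinctionBuildsQCD.Negative.ExtinctIntegrable
import Summits.QuantumFields.QCD.Theorems.ExtinctionBuildsQCD.Negative.WeylWindow

/-!
# Stub `stub_branchOfFloor` of line `dilution-buys-local-rarity`
(crux `Summit.QuantumFields.QCD.Theses.SpectralDefectExtinction.ExtinctionBuildsQCD`, item stmt-QuantumFields-8968)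

**TIGHT consumer, kernel half: EXTINCT ∧ TIGHT above `M₀` plus a real-mode floor put the witness's line on the
physical branch, `−1 < m_crit(k)` eventually.** This is the lead's cycle-2 reshape of the planner's
`stub_honestMass` (split into the unlanded physics inputs `stub_honestMassInputs` — a phase-quenched FLOOR
`η > 0` on the expected number of physical-branch real modes of `D_W(U,0,1)` (real eigenvalues with real part
`< 1/2`) on the scheme torus, and the lightness clause — and this kernel-checked reduction, found and proved by
the stub worker W3 of this line).

Proof (`branchClause_of_realModeFloor`): at a step with `m_crit(k) ≤ −1`, the landed pin
`Tight.eventually_probe_mem` (`Negative/TightPinsLine.lean`) used at the two probe masses `M = M₀+1` and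
`M = 17(M₀+1)` gives `a_k(M₀+1)/Z_k ≤ 1/2` — no smallness lemma `a_k/Z_k → 0` is needed — so `−m_f(k) ≥ 1/2` at
the tuple `m ≡ M₀+1` and every floor mode is an EXTINCT(a) sign defect; EXTINCT with `ε = η/2` at `S = L_k`
(volume factor `1`, `integrable_extinctIntegrand`) contradicts the floor. The volume cap, mass scaling and
asymptotic scaling are not used.
-/

noncomputable section

open scoped BigOperators Topology
open MeasureTheory Filter
open Literature.MathematicalPhysics.AQFT Literature.Probability.LatticeModels
  Literature.MathematicalPhysics.QuantumLattice Literature.MathematicalPhysics.QuantumFieldTheory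
open Summit.QuantumFields.QCD.Theses.SpectralDefectExtinction
open Summit.QuantumFields.QCD.Theorems.ExtinctionBuildsQCD.Negative

namespace Summit.QuantumFields.QCD.Cruxes.ExtinctionBuildsQCD.DilutionBuysLocalRarity

/-- **The branch clause from a real-mode floor.** If `(reg, M₀, c)` satisfies
`Extinct ∧ Tight` above `M₀ ≥ 0` (the spectral part of `CappedSD`; the cap, mass scaling and asymptotic
scaling are not used), and the phase-quenched expected number of real eigenvalues of `D_W(U,0,1)` with
real part `< 1/2` on the scheme torus `(2L_k+1)⁴`, weighted by `∏_f |det D_W(U, m_f(k), 1)|` at the tuple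
`m ≡ M₀ + 1`, is eventually `≥ η > 0`, then the line lies eventually on the physical branch,
`-1 < m_crit(k)`. Proof: at a step with `m_crit(k) ≤ -1`, the pin gives `a_k(M₀+1)/Z_k ≤ 1/2`, so
`-m_f(k) ≥ 1/2` and every floor mode is an EXTINCT(a) sign defect; EXTINCT with `ε = η/2` at `S = L_k`
contradicts the floor. -/
theorem branchClause_of_realModeFloor {Nf : ℕ} (reg : QCDRegularisation Nf) (M₀ c : ℝ)
    (hM₀ : 0 ≤ M₀)
    (hSD : ∀ m : Fin Nf → ℝ, (∀ f, M₀ < m f) → Extinct Nf reg c m ∧ Tight Nf reg M₀ m)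
    {η : ℝ} (hη : 0 < η)
    (hfloor : ∀ᶠ k : ℕ in atTop, η ≤ (∫ U, (∑ _f : Fin Nf, (Multiset.countP (fun z : ℂ => z.im = 0 ∧ z.re < 1 / 2) (wilsonDirac (fundamentalRep (Fin 3)) U 0 1).charpoly.roots : ℝ)) * ∏ _f : Fin Nf, ‖fermionDet (wilsonDirac (fundamentalRep (Fin 3)) U (reg.mcrit k + reg.a k * (M₀ + 1) / reg.Zm k) 1)‖ ∂(wilsonMeasure (d := 4) (L := 2 * reg.L k + 1) (fundamentalRep (Fin 3)) (reg.β k))) / (∫ U, ∏ _f : Fin Nf, ‖fermionDet (wilsonDirac (fundamentalRep (Fin 3)) U (reg.mcrit k + reg.a k * (M₀ + 1) / reg.Zm k) 1)‖ ∂(wilsonMeasure (d := 4) (L := 2 * reg.L k + 1) (fundamentalRep (Fin 3)) (reg.β k)))) :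
    ∀ᶠ k : ℕ in atTop, -1 < reg.mcrit k := by
  obtain ⟨hE, hT⟩ := hSD (fun _ => M₀ + 1) (fun _ => by linarith)
  have hε := hE (η / 2) (by positivity)
  have h1 := Tight.eventually_probe_mem reg M₀ (fun _ => M₀ + 1) hT (M := M₀ + 1) (by linarith)
  have h2 := Tight.eventually_probe_mem reg M₀ (fun _ => M₀ + 1) hT (M := 17 * (M₀ + 1))
    (by nlinarith)
  filter_upwards [hfloor, hε, h1, h2] with k hfl hex hk1 hk2
  by_contra hneg
  have hneg' : reg.mcrit k ≤ -1 := not_lt.mp hneg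
  -- the pin at two probe masses bounds the bare distance: `a_k (M₀+1)/Z_k ≤ 1/2`
  have ht : reg.a k * (M₀ + 1) / reg.Zm k ≤ 1 / 2 := by
    have e : reg.a k * (17 * (M₀ + 1)) / reg.Zm k = 17 * (reg.a k * (M₀ + 1) / reg.Zm k) := by
      ring
    have h2' := hk2.1
    rw [e] at h2'
    linarith [hk1.2]
  have hthr : (1 / 2 : ℝ) ≤ -(reg.mcrit k + reg.a k * (M₀ + 1) / reg.Zm k) := by linarith
  -- EXTINCT on the scheme torus `S = L_k`
  have hex3 := hex (reg.L k) le_rfl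
  have hS : ((2 * (reg.L k : ℝ) + 1) / (2 * reg.L k + 1)) ^ 4 = 1 := by
    rw [div_self (by positivity : (2 * (reg.L k : ℝ) + 1) ≠ 0), one_pow]
  rw [hS, mul_one] at hex3
  have hden : 0 ≤ ∫ U, ∏ _f : Fin Nf, ‖fermionDet (wilsonDirac (fundamentalRep (Fin 3)) U
      (reg.mcrit k + reg.a k * (M₀ + 1) / reg.Zm k) 1)‖
        ∂(wilsonMeasure (d := 4) (L := 2 * reg.L k + 1) (fundamentalRep (Fin 3)) (reg.β k)) :=
    integral_nonneg fun U => Finset.prod_nonneg fun _ _ => norm_nonneg _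
  have hchain : η ≤ η / 2 := by
    refine hfl.trans ((div_le_div_of_nonneg_right ?_ hden).trans hex3)
    refine integral_mono_of_nonneg (Eventually.of_forall fun U => ?_)
      (integrable_extinctIntegrand reg c k (fun _ => M₀ + 1) (reg.β k))
      (Eventually.of_forall fun U => ?_)
    · exact mul_nonneg (Finset.sum_nonneg fun _ _ => by positivity)
        (Finset.prod_nonneg fun _ _ => norm_nonneg _)
    · refine mul_le_mul_of_nonneg_right (Finset.sum_le_sum fun f _ => ?_)
        (Finset.prod_nonneg fun _ _ => norm_nonneg _)
      refine le_trans ?_ (le_add_of_nonneg_right (by positivity))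
      exact Nat.cast_le.mpr (countP_le_countP_of_imp _ fun z hz => ⟨hz.1, lt_of_lt_of_le hz.2 hthr⟩)
  linarith


/-- `stub_branchOfFloor` — **TIGHT consumer, kernel half: EXTINCT ∧ TIGHT above `M₀ ≥ 0` plus a real-mode floor
(`∃ η > 0`, eventually the phase-quenched expected number of real eigenvalues of `D_W(U,0,1)` with real part
`< 1/2` on the scheme torus, weighted at `m ≡ M₀+1`, is `≥ η`) give `−1 < m_crit(k)` eventually**
(`branchClause_of_realModeFloor` with the floor's `η` unpacked). -/
theorem stub_branchOfFloor :
    ∀ (Nf : ℕ) (reg : QCDRegularisation Nf) (M₀ c : ℝ), 0 ≤ M₀ →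
      (∀ m : Fin Nf → ℝ, (∀ f, M₀ < m f) → Extinct Nf reg c m ∧ Tight Nf reg M₀ m) →
        (∃ η : ℝ, 0 < η ∧ ∀ᶠ k : ℕ in atTop, η ≤ (∫ U, (∑ _f : Fin Nf, (Multiset.countP (fun z : ℂ => z.im = 0 ∧ z.re < 1 / 2) (wilsonDirac (fundamentalRep (Fin 3)) U 0 1).charpoly.roots : ℝ)) * ∏ _f : Fin Nf, ‖fermionDet (wilsonDirac (fundamentalRep (Fin 3)) U (reg.mcrit k + reg.a k * (M₀ + 1) / reg.Zm k) 1)‖ ∂(qcdGaugeMeasure (reg.scheme (fun _ => M₀ + 1) 0 0) k)) / (∫ U, ∏ _f : Fin Nf, ‖fermionDet (wilsonDirac (fundamentalRep (Fin 3)) U (reg.mcrit k + reg.a k * (M₀ + 1) / reg.Zm k) 1)‖ ∂(qcdGaugeMeasure (reg.scheme (fun _ => M₀ + 1) 0 0) k))) →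
          ∀ᶠ k : ℕ in atTop, -1 < reg.mcrit k := by
  intro Nf reg M₀ c hM₀ hSD hfloor
  obtain ⟨η, hη, hfl⟩ := hfloor
  exact branchClause_of_realModeFloor reg M₀ c hM₀ hSD hη hfl

end Summit.QuantumFields.QCD.Cruxes.ExtinctionBuildsQCD.DilutionBuysLocalRarity

end
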